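import Summits.ResolutionOfSingularities.ResolutionOfSingularities.Theorems.FrobeniusLadderFInjectiveMacaulayficationX2CubicFormFSideChar2
import Summits.ResolutionOfSingularities.ResolutionOfSingularities.Theorems.FrobeniusLadderFInjectiveMacaulayficationX2CubicFormSmoothCert
import HarnessLib

/-!
# THE CYCLIC CUBIC `F = Y₀²Y₁ + Y₁²Y₂ + Y₂²Y₃ + Y₃²Y₀` AT `p = 2`: `x² + F` is a member of the p = 2 smooth-cubic F-side class row OUTSIDE the Fermat family — certificates
# (homogeneous, every monomial contains a square, `x² + F` prime, isolated at `p = 2`, chart cubics prime and smooth at `p = 2`) and the rows (F-side census pair, and lead-1's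
# T-side row as a by-product: kernel T-instance beyond Fermat at `p = 2`)
# (crux `FInjectiveMacaulayfication` stmt-ResolutionOfSingularities-15315, chain w45a; res-L1-w45a-plan-1 RULING R22.15 (3) «instances: Fermat (p = 2) and the cyclic cubic (p = 2)»,
# R22.16 (3); the cyclic cubic is res-L1-w45a-tri-2 g20's non-emptiness witness (LENS ANSWER 2, `g20/tcl/cubic_smooth.py`); seat res-L1-w45a-stub-1 g14; sequel of
# ✓ `…X2CubicFormFSideChar2`)

[OURS · L1 W4.5a] Support file (`--supports stmt-ResolutionOfSingularities-15315 --as helper`); def-free; UNCONDITIONAL; no named fact; NOT a statement of any manuscript. HONEST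
BILLING: one more member (at `p = 2`) of the simplest-kind F-side class row (cure = point floor) and of lead-1's T-side class row; evidence for nothing about composite centres;
nothing of the crux is proved. AI-written (AI review is weaker than expert review).

Letters: `F = Y₀²Y₁ + Y₁²Y₂ + Y₂²Y₃ + Y₃²Y₀ ∈ k[Y₀..Y₃]`, `f = X₄² + F(X₀..X₃) = X₄² + X₀²X₁ + X₁²X₂ + X₂²X₃ + X₃²X₀`, `v` the vertex of `Y = Spec k[X]/(f)`.
* §1 (any `k`) `cyclic_isHomogeneous`, `cyclic_support_sq`, `f_eq`, ★ `prime_f` (`T² + C(s)`, `s = F`, Eisenstein-type at `(1,0,0,0)`: `s = 0`, `∂s/∂Y₁ = Y₀² + 2Y₁Y₂ = 1` there —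
  ✓ `irreducible_X_pow_add_C`), `dehomogenisation_cyclic` (the chart cubics `w₀ = Z₀ + Z₀²Z₁ + Z₁²Z₂ + Z₂² = w₃`, `w₁ = Z₀² + Z₁ + Z₁²Z₂ + Z₀Z₂²`, `w₂ = Z₀²Z₁ + Z₁² + Z₂ + Z₀Z₂²`),
  `irreducible_model` (`T² + C(Z₁²)·T + C(Z₀ + Z₀²Z₁)` is irreducible: Eisenstein-type at `0`, ✓ `irreducible_X_pow_add_C_mul_X_add_C`), ★ `prime_chartCubic` (each `w_a` is a renaming of
  that model: all four prime, EVERY characteristic).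
* §2 (`char k = 2`) ★ `regular_off_vertex` (the partials are `Y₃², Y₀², Y₁², Y₂²` and `0`: at a prime `P ⊉ 𝔪` some `Y_j ∉ P`, and `Y_j² = ∂f/∂Y_{j+1}`; if all `Y_j ∈ P` then
  `X₄² = f − F ∈ P` — excluded), ★ `smooth_chartCubic` (in characteristic 2 each `w_a` has a partial derivative EQUAL TO `1`: `∂w₀/∂Z₀ = 1 + 2Z₀Z₁`, … — Jacobian certificate with one
  cofactor, ✓ `X2CubicFormSmoothCert.smooth_of_jacobian_certificate`).
* §3 ★ `cyclic_fSide_row_char2` (the full F-side class row of ✓ `X2CubicFormFSideChar2.fSide_classRow_smoothCubic_char2` + the germ), `cyclic_bad_germ_row_char2` (census pair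
  `¬ FullCl 2 ∧ FInjectivizationGermAt 2 v`), and the T-side by-product `cyclic_tStep_row_char2` (lead-1's ✓ `tStep_row_of_doublePoint_cubicForm` at `p = 2` on this bed: a kernel
  T-instance outside the Fermat family, whose Fermat member needs `p ∉ {2,3}` for its published certificates).
[folklore mathematics, OURS as a certificate; cite: Fedder1983, Thm. 1.12; Hartshorne1977, I Thm. 5.1; StacksProject, Tag 07PF]
-/

-- single-problem summit: the doubled namespace component is forced
set_option linter.dupNamespace false

noncomputable section

namespace Summit.ResolutionOfSingularities.ResolutionOfSingularities.Theorems.FInjectiveMacaulayfication.X2CyclicCubicChar2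

open CategoryTheory CategoryTheory.Limits AlgebraicGeometry TopologicalSpace IsLocalRing MvPolynomial
open Literature.AlgebraicGeometry.Resolution
open Summit.ResolutionOfSingularities.ResolutionOfSingularities.Theorems.FInjectiveMacaulayfication
open SliceableCentre GermForm

variable (k : Type) [Field k]

/-! ## §1 Characteristic-free certificates -/

/-- The cyclic cubic is homogeneous of degree 3. [elementary] -/
theorem cyclic_isHomogeneous : (X 0 ^ 2 * X 1 + X 1 ^ 2 * X 2 + X 2 ^ 2 * X 3 + X 3 ^ 2 * X 0 : MvPolynomial (Fin 4) k).IsHomogeneous 3 :=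
  ((((isHomogeneous_X_pow (R := k) (0 : Fin 4) 2).mul (isHomogeneous_X k (1 : Fin 4))).add
    ((isHomogeneous_X_pow (R := k) (1 : Fin 4) 2).mul (isHomogeneous_X k (2 : Fin 4)))).add
    ((isHomogeneous_X_pow (R := k) (2 : Fin 4) 2).mul (isHomogeneous_X k (3 : Fin 4)))).add
    ((isHomogeneous_X_pow (R := k) (3 : Fin 4) 2).mul (isHomogeneous_X k (0 : Fin 4)))

/-- Every monomial of the cyclic cubic contains a square. [elementary] -/
theorem cyclic_support_sq : ∀ d ∈ (X 0 ^ 2 * X 1 + X 1 ^ 2 * X 2 + X 2 ^ 2 * X 3 + X 3 ^ 2 * X 0 : MvPolynomial (Fin 4) k).support, ∃ i, 2 ≤ d i := by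
  classical
  intro d hd
  have e : (X 0 ^ 2 * X 1 + X 1 ^ 2 * X 2 + X 2 ^ 2 * X 3 + X 3 ^ 2 * X 0 : MvPolynomial (Fin 4) k) =
      monomial (Finsupp.single 0 2 + Finsupp.single 1 1) 1 + monomial (Finsupp.single 1 2 + Finsupp.single 2 1) 1 +
        monomial (Finsupp.single 2 2 + Finsupp.single 3 1) 1 + monomial (Finsupp.single 3 2 + Finsupp.single 0 1) 1 := by
    rw [show (X 0 ^ 2 * X 1 + X 1 ^ 2 * X 2 + X 2 ^ 2 * X 3 + X 3 ^ 2 * X 0 : MvPolynomial (Fin 4) k) =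
      X 0 ^ 2 * X 1 ^ 1 + X 1 ^ 2 * X 2 ^ 1 + X 2 ^ 2 * X 3 ^ 1 + X 3 ^ 2 * X 0 ^ 1 by simp only [pow_one]]
    simp only [X_pow_eq_monomial, monomial_mul, mul_one]
  rw [e] at hd
  rcases Finset.mem_union.mp (support_add hd) with h | h
  · rcases Finset.mem_union.mp (support_add h) with h | h
    · rcases Finset.mem_union.mp (support_add h) with h | h
      · exact ⟨0, by rw [CensusBedsWeaklyNondegenerate.eq_of_mem_support_monomial h]; simp⟩
      · exact ⟨1, by rw [CensusBedsWeaklyNondegenerate.eq_of_mem_support_monomial h]; simp⟩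
    · exact ⟨2, by rw [CensusBedsWeaklyNondegenerate.eq_of_mem_support_monomial h]; simp⟩
  · exact ⟨3, by rw [CensusBedsWeaklyNondegenerate.eq_of_mem_support_monomial h]; simp⟩

/-- `f = X₄² + F(X₀..X₃)` written out. [plumbing] -/
theorem f_eq (f : MvPolynomial (Fin 5) k)
    (hf : f = X 4 ^ 2 + rename (Fin.castSucc : Fin 4 → Fin 5) (X 0 ^ 2 * X 1 + X 1 ^ 2 * X 2 + X 2 ^ 2 * X 3 + X 3 ^ 2 * X 0 : MvPolynomial (Fin 4) k)) :
    f = X 4 ^ 2 + X 0 ^ 2 * X 1 + X 1 ^ 2 * X 2 + X 2 ^ 2 * X 3 + X 3 ^ 2 * X 0 := by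
  rw [hf]
  simp only [map_add, map_mul, map_pow, rename_X]
  have e0 : (Fin.castSucc (0 : Fin 4) : Fin 5) = 0 := rfl
  have e1 : (Fin.castSucc (1 : Fin 4) : Fin 5) = 1 := rfl
  have e2 : (Fin.castSucc (2 : Fin 4) : Fin 5) = 2 := rfl
  have e3 : (Fin.castSucc (3 : Fin 4) : Fin 5) = 3 := rfl
  rw [e0, e1, e2, e3]
  ring

/-- ★ **`f = X₄² + X₀²X₁ + X₁²X₂ + X₂²X₃ + X₃²X₀` is PRIME over every field**: as `T² + C(s)` over `k[Y₀..Y₃]`, `s` the cyclic cubic, Eisenstein-type at `(1, 0, 0, 0)` where `s = 0` and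
`∂s/∂Y₁ = Y₀² + 2Y₁Y₂ = 1` (✓ `irreducible_X_pow_add_C`). [folklore] -/
theorem prime_f (f : MvPolynomial (Fin 5) k)
    (hf : f = X 4 ^ 2 + rename (Fin.castSucc : Fin 4 → Fin 5) (X 0 ^ 2 * X 1 + X 1 ^ 2 * X 2 + X 2 ^ 2 * X 3 + X 3 ^ 2 * X 0 : MvPolynomial (Fin 4) k)) : Prime f := by
  have hf' := f_eq k f hf
  set e : MvPolynomial (Fin 5) k ≃+* Polynomial (MvPolynomial (Fin 4) k) :=
    ((renameEquiv k (_root_.finRotate 5)).trans (finSuccEquiv k 4)).toRingEquiv with he_def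
  have hrot4 : (_root_.finRotate 5) (4 : Fin 5) = 0 := by decide
  have hrot : ∀ j : Fin 4, (_root_.finRotate 5) (Fin.castSucc j) = j.succ := by decide
  have he4 : e (X 4) = Polynomial.X := by
    show finSuccEquiv k 4 (rename _ (X 4)) = _
    rw [rename_X, hrot4]; exact finSuccEquiv_X_zero
  have hej : ∀ j : Fin 4, e (X (Fin.castSucc j)) = Polynomial.C (X j) := fun j => by
    show finSuccEquiv k 4 (rename _ (X (Fin.castSucc j))) = _
    rw [rename_X, hrot j]; exact finSuccEquiv_X_succ (j := j)
  set s : MvPolynomial (Fin 4) k := X 0 ^ 2 * X 1 + X 1 ^ 2 * X 2 + X 2 ^ 2 * X 3 + X 3 ^ 2 * X 0 with hs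
  have hef : e f = Polynomial.X ^ 2 + Polynomial.C s := by
    rw [hf', map_add, map_add, map_add, map_add, map_pow, he4, map_mul, map_mul, map_mul, map_mul, map_pow, map_pow, map_pow, map_pow,
      show (0 : Fin 5) = Fin.castSucc (0 : Fin 4) from rfl, show (1 : Fin 5) = Fin.castSucc (1 : Fin 4) from rfl,
      show (2 : Fin 5) = Fin.castSucc (2 : Fin 4) from rfl, show (3 : Fin 5) = Fin.castSucc (3 : Fin 4) from rfl, hej, hej, hej, hej, hs]
    simp only [map_add, map_mul, map_pow]
    ring
  set q : Fin 4 → k := ![1, 0, 0, 0] with hq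
  have hsq : MvPolynomial.eval q s = 0 := by
    rw [hs]
    simp [hq]
  have hder : MvPolynomial.eval q (pderiv 1 s) ≠ 0 := by
    have e1 : pderiv 1 s = X 0 ^ 2 + 2 * X 1 * X 2 := by
      rw [hs]
      simp only [map_add, Derivation.leibniz, Derivation.leibniz_pow, pderiv_X_self, pderiv_X_of_ne (show (0 : Fin 4) ≠ 1 by decide),
        pderiv_X_of_ne (show (2 : Fin 4) ≠ 1 by decide), pderiv_X_of_ne (show (3 : Fin 4) ≠ 1 by decide), smul_eq_mul, nsmul_eq_mul]
      push_cast
      ring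
    rw [e1]
    simp [hq]
  have hirr : Irreducible (e f) := by
    rw [hef]
    exact Literature.AlgebraicGeometry.Motives.SmoothHypersurface.irreducible_X_pow_add_C (d := 2) (by norm_num) s q hsq 1 hder
  exact (MulEquiv.prime_iff e).mp hirr.prime

/-- **The four dehomogenisations of the cyclic cubic**: `w₀ = Z₀ + Z₀²Z₁ + Z₁²Z₂ + Z₂²`, `w₁ = Z₀² + Z₁ + Z₁²Z₂ + Z₀Z₂²`, `w₂ = Z₀²Z₁ + Z₁² + Z₂ + Z₀Z₂²`, `w₃ = w₀`. [elementary] -/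
theorem dehomogenisation_cyclic (a : Fin 4) :
    MvPolynomial.aeval ((![![1, X 0, X 1, X 2], ![X 0, 1, X 1, X 2], ![X 0, X 1, 1, X 2], ![X 0, X 1, X 2, 1]] : Fin 4 → Fin 4 → MvPolynomial (Fin 3) k) a)
      (X 0 ^ 2 * X 1 + X 1 ^ 2 * X 2 + X 2 ^ 2 * X 3 + X 3 ^ 2 * X 0 : MvPolynomial (Fin 4) k) =
      (![X 0 + X 0 ^ 2 * X 1 + X 1 ^ 2 * X 2 + X 2 ^ 2, X 0 ^ 2 + X 1 + X 1 ^ 2 * X 2 + X 0 * X 2 ^ 2,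
        X 0 ^ 2 * X 1 + X 1 ^ 2 + X 2 + X 0 * X 2 ^ 2, X 0 + X 0 ^ 2 * X 1 + X 1 ^ 2 * X 2 + X 2 ^ 2] : Fin 4 → MvPolynomial (Fin 3) k) a := by
  fin_cases a <;> simp <;> ring

/-- **The model quadratic `T² + C(Z₁²)·T + C(Z₀ + Z₀²Z₁) ∈ k[Z₀,Z₁][T]` is irreducible** (Eisenstein-type at the origin: `Z₁²(0) = 0`, `(Z₀ + Z₀²Z₁)(0) = 0`, `∂(Z₀ + Z₀²Z₁)/∂Z₀ (0) = 1`).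
[folklore] -/
theorem irreducible_model :
    Irreducible (Polynomial.X ^ 2 + Polynomial.C ((X 1 : MvPolynomial (Fin 2) k) ^ 2) * Polynomial.X + Polynomial.C ((X 0 : MvPolynomial (Fin 2) k) + X 0 ^ 2 * X 1)) := by
  refine Literature.AlgebraicGeometry.Motives.SmoothHypersurface.irreducible_X_pow_add_C_mul_X_add_C (d := 2) le_rfl _ _ (0 : Fin 2 → k) (by simp) (by simp) 0 ?_
  have e1 : pderiv 0 ((X 0 : MvPolynomial (Fin 2) k) + X 0 ^ 2 * X 1) = 1 + 2 * X 0 * X 1 := by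
    simp only [map_add, Derivation.leibniz, Derivation.leibniz_pow, pderiv_X_self, pderiv_X_of_ne (show (1 : Fin 2) ≠ 0 by decide), smul_eq_mul, nsmul_eq_mul]
    push_cast
    ring
  rw [e1]
  simp

/-- ★ **The four chart cubics are PRIME over every field**: each is carried to the model quadratic of `irreducible_model` by a ring isomorphism `k[Z₀,Z₁,Z₂] ≃ k[Z₀,Z₁][T]` singling
out the variable in which it is monic quadratic (`Z₂` for `w₀ = w₃`, `Z₀` for `w₁`, `Z₁` for `w₂`). [folklore] -/
theorem prime_chartCubic (a : Fin 4) :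
    Prime (MvPolynomial.aeval ((![![1, X 0, X 1, X 2], ![X 0, 1, X 1, X 2], ![X 0, X 1, 1, X 2], ![X 0, X 1, X 2, 1]] : Fin 4 → Fin 4 → MvPolynomial (Fin 3) k) a)
      (X 0 ^ 2 * X 1 + X 1 ^ 2 * X 2 + X 2 ^ 2 * X 3 + X 3 ^ 2 * X 0 : MvPolynomial (Fin 4) k)) := by
  rw [dehomogenisation_cyclic]
  -- the three isomorphisms: `σ` a permutation of the variables, then `finSuccEquiv` (`Z₀ ↦ T`, `Z_{j+1} ↦ C Z_j`)
  have key : ∀ (σ : Equiv.Perm (Fin 3)) (w : MvPolynomial (Fin 3) k),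
      ((renameEquiv k σ).trans (finSuccEquiv k 2)).toRingEquiv w =
        Polynomial.X ^ 2 + Polynomial.C ((X 1 : MvPolynomial (Fin 2) k) ^ 2) * Polynomial.X + Polynomial.C ((X 0 : MvPolynomial (Fin 2) k) + X 0 ^ 2 * X 1) → Prime w := by
    intro σ w hw
    have hirr : Irreducible (((renameEquiv k σ).trans (finSuccEquiv k 2)).toRingEquiv w) := by rw [hw]; exact irreducible_model k
    exact (MulEquiv.prime_iff ((renameEquiv k σ).trans (finSuccEquiv k 2)).toRingEquiv).mp hirr.prime
  have hT : ∀ σ : Equiv.Perm (Fin 3), ∀ i : Fin 3, σ i = 0 → ((renameEquiv k σ).trans (finSuccEquiv k 2)).toRingEquiv (X i) = Polynomial.X := by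
    intro σ i hi
    show finSuccEquiv k 2 (rename σ (X i)) = _
    rw [rename_X, hi]; exact finSuccEquiv_X_zero
  have hC : ∀ σ : Equiv.Perm (Fin 3), ∀ (i : Fin 3) (j : Fin 2), σ i = j.succ → ((renameEquiv k σ).trans (finSuccEquiv k 2)).toRingEquiv (X i) = Polynomial.C (X j) := by
    intro σ i j hij
    show finSuccEquiv k 2 (rename σ (X i)) = _
    rw [rename_X, hij]; exact finSuccEquiv_X_succ (j := j)
  have hmodel : ∀ (σ : Equiv.Perm (Fin 3)) (t c₀ c₁ : Fin 3), σ t = 0 → σ c₀ = (0 : Fin 2).succ → σ c₁ = (1 : Fin 2).succ →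
      ((renameEquiv k σ).trans (finSuccEquiv k 2)).toRingEquiv ((X t : MvPolynomial (Fin 3) k) ^ 2 + X c₁ ^ 2 * X t + (X c₀ + X c₀ ^ 2 * X c₁)) =
        Polynomial.X ^ 2 + Polynomial.C ((X 1 : MvPolynomial (Fin 2) k) ^ 2) * Polynomial.X + Polynomial.C ((X 0 : MvPolynomial (Fin 2) k) + X 0 ^ 2 * X 1) := by
    intro σ t c₀ c₁ ht h₀ h₁
    simp only [map_add, map_mul, map_pow, hT σ t ht, hC σ c₀ 0 h₀, hC σ c₁ 1 h₁]
  obtain rfl | rfl | rfl | rfl : a = 0 ∨ a = 1 ∨ a = 2 ∨ a = 3 := by fin_cases a <;> simp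
  · -- `w₀`: `Z₂ ↦ T`, `Z₀ ↦ C Z₀`, `Z₁ ↦ C Z₁` via `σ = finRotate 3` (`0 ↦ 1`, `1 ↦ 2`, `2 ↦ 0`)
    refine key (_root_.finRotate 3) _ ?_
    rw [← hmodel (_root_.finRotate 3) 2 0 1 (by decide) (by decide) (by decide)]
    congr 1
    show (X 0 + X 0 ^ 2 * X 1 + X 1 ^ 2 * X 2 + X 2 ^ 2 : MvPolynomial (Fin 3) k) = _
    ring
  · -- `w₁`: `Z₀ ↦ T`, `Z₁ ↦ C Z₀`, `Z₂ ↦ C Z₁` via `σ = 1`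
    refine key 1 _ ?_
    rw [← hmodel 1 0 1 2 (by decide) (by decide) (by decide)]
    congr 1
    show (X 0 ^ 2 + X 1 + X 1 ^ 2 * X 2 + X 0 * X 2 ^ 2 : MvPolynomial (Fin 3) k) = _
    ring
  · -- `w₂`: `Z₁ ↦ T`, `Z₂ ↦ C Z₀`, `Z₀ ↦ C Z₁` via `σ = (finRotate 3).symm` (`0 ↦ 2`, `1 ↦ 0`, `2 ↦ 1`)
    refine key (_root_.finRotate 3).symm _ ?_
    rw [← hmodel (_root_.finRotate 3).symm 1 2 0 (by decide) (by decide) (by decide)]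
    congr 1
    show (X 0 ^ 2 * X 1 + X 1 ^ 2 + X 2 + X 0 * X 2 ^ 2 : MvPolynomial (Fin 3) k) = _
    ring
  · -- `w₃ = w₀`
    refine key (_root_.finRotate 3) _ ?_
    rw [← hmodel (_root_.finRotate 3) 2 0 1 (by decide) (by decide) (by decide)]
    congr 1
    show (X 0 + X 0 ^ 2 * X 1 + X 1 ^ 2 * X 2 + X 2 ^ 2 : MvPolynomial (Fin 3) k) = _
    ring

/-! ## §2 Characteristic 2: isolatedness and chart smoothness -/

/-- The partial derivatives of `f` in characteristic 2: `∂₀f = X₃²`, `∂₁f = X₀²`, `∂₂f = X₁²`, `∂₃f = X₂²`. [elementary] -/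
theorem pderiv_f [CharP k 2] (f : MvPolynomial (Fin 5) k)
    (hf : f = X 4 ^ 2 + rename (Fin.castSucc : Fin 4 → Fin 5) (X 0 ^ 2 * X 1 + X 1 ^ 2 * X 2 + X 2 ^ 2 * X 3 + X 3 ^ 2 * X 0 : MvPolynomial (Fin 4) k)) :
    pderiv 0 f = X 3 ^ 2 ∧ pderiv 1 f = X 0 ^ 2 ∧ pderiv 2 f = X 1 ^ 2 ∧ pderiv 3 f = X 2 ^ 2 := by
  have h2 : (2 : MvPolynomial (Fin 5) k) = 0 := by
    have := CharP.cast_eq_zero (MvPolynomial (Fin 5) k) 2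
    simpa using this
  rw [f_eq k f hf]
  refine ⟨?_, ?_, ?_, ?_⟩
  · simp only [map_add, Derivation.leibniz, Derivation.leibniz_pow, pderiv_X_self, smul_eq_mul, nsmul_eq_mul,
      pderiv_X_of_ne (show (1 : Fin 5) ≠ 0 by decide), pderiv_X_of_ne (show (2 : Fin 5) ≠ 0 by decide), pderiv_X_of_ne (show (3 : Fin 5) ≠ 0 by decide),
      pderiv_X_of_ne (show (4 : Fin 5) ≠ 0 by decide)]
    push_cast
    linear_combination (X 0 * X 1 : MvPolynomial (Fin 5) k) * h2
  · simp only [map_add, Derivation.leibniz, Derivation.leibniz_pow, pderiv_X_self, smul_eq_mul, nsmul_eq_mul,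
      pderiv_X_of_ne (show (0 : Fin 5) ≠ 1 by decide), pderiv_X_of_ne (show (2 : Fin 5) ≠ 1 by decide), pderiv_X_of_ne (show (3 : Fin 5) ≠ 1 by decide),
      pderiv_X_of_ne (show (4 : Fin 5) ≠ 1 by decide)]
    push_cast
    linear_combination (X 1 * X 2 : MvPolynomial (Fin 5) k) * h2
  · simp only [map_add, Derivation.leibniz, Derivation.leibniz_pow, pderiv_X_self, smul_eq_mul, nsmul_eq_mul,
      pderiv_X_of_ne (show (0 : Fin 5) ≠ 2 by decide), pderiv_X_of_ne (show (1 : Fin 5) ≠ 2 by decide), pderiv_X_of_ne (show (3 : Fin 5) ≠ 2 by decide),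
      pderiv_X_of_ne (show (4 : Fin 5) ≠ 2 by decide)]
    push_cast
    linear_combination (X 2 * X 3 : MvPolynomial (Fin 5) k) * h2
  · simp only [map_add, Derivation.leibniz, Derivation.leibniz_pow, pderiv_X_self, smul_eq_mul, nsmul_eq_mul,
      pderiv_X_of_ne (show (0 : Fin 5) ≠ 3 by decide), pderiv_X_of_ne (show (1 : Fin 5) ≠ 3 by decide), pderiv_X_of_ne (show (2 : Fin 5) ≠ 3 by decide),
      pderiv_X_of_ne (show (4 : Fin 5) ≠ 3 by decide)]
    push_cast
    linear_combination (X 3 * X 0 : MvPolynomial (Fin 5) k) * h2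

/-- ★ **`Y` is regular off the vertex in characteristic 2.** At a prime `P ⊉ 𝔪` (containing `f`): if `X₀, …, X₃ ∈ P` then `X₄² = f − F ∈ P`, `X₄ ∈ P`, `𝔪 ≤ P` — excluded; so some
`X_j ∉ P`, `j ≤ 3`, and `X_j² ∈ {∂₁f, ∂₂f, ∂₃f, ∂₀f}` is a partial derivative outside `P` (Jacobian criterion ✓ `HypersurfaceRegular.stub_hypersurfaceRegularOfPderiv`).
[cite: Hartshorne1977, I Thm. 5.1] -/
theorem regular_off_vertex [CharP k 2] (f : MvPolynomial (Fin 5) k)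
    (hf : f = X 4 ^ 2 + rename (Fin.castSucc : Fin 4 → Fin 5) (X 0 ^ 2 * X 1 + X 1 ^ 2 * X 2 + X 2 ^ 2 * X 3 + X 3 ^ 2 * X 0 : MvPolynomial (Fin 4) k))
    (P : Ideal (MvPolynomial (Fin 5) k ⧸ Ideal.span {f})) [P.IsPrime]
    (hP : ¬ Ideal.span (Set.range fun j : Fin 5 => Ideal.Quotient.mk (Ideal.span {f}) (X j)) ≤ P) :
    IsRegularLocalRing (Localization.AtPrime P) := by
  have hP' : (P.comap (Ideal.Quotient.mk (Ideal.span {f}))).IsPrime := Ideal.comap_isPrime _ _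
  set P' := P.comap (Ideal.Quotient.mk (Ideal.span {f})) with hP'def
  have hfP : f ∈ P' := by
    rw [hP'def, Ideal.mem_comap, Ideal.Quotient.eq_zero_iff_mem.mpr (Ideal.mem_span_singleton_self f)]
    exact P.zero_mem
  have hex : ∃ j : Fin 5, j ≠ 4 ∧ (X j : MvPolynomial (Fin 5) k) ∉ P' := by
    by_contra hall
    push Not at hall
    apply hP
    have hs : (X 0 : MvPolynomial (Fin 5) k) ^ 2 * X 1 + X 1 ^ 2 * X 2 + X 2 ^ 2 * X 3 + X 3 ^ 2 * X 0 ∈ P' :=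
      add_mem (add_mem (add_mem (Ideal.mul_mem_left _ _ (hall 1 (by decide))) (Ideal.mul_mem_left _ _ (hall 2 (by decide))))
        (Ideal.mul_mem_left _ _ (hall 3 (by decide)))) (Ideal.mul_mem_left _ _ (hall 0 (by decide)))
    have h4c : (X 4 : MvPolynomial (Fin 5) k) ^ 2 ∈ P' := by
      have e : (X 4 : MvPolynomial (Fin 5) k) ^ 2 = f - (X 0 ^ 2 * X 1 + X 1 ^ 2 * X 2 + X 2 ^ 2 * X 3 + X 3 ^ 2 * X 0) := by rw [f_eq k f hf]; ring
      rw [e]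
      exact sub_mem hfP hs
    have h4 : (X 4 : MvPolynomial (Fin 5) k) ∈ P' := hP'.mem_of_pow_mem 2 h4c
    rw [Ideal.span_le]
    rintro _ ⟨j, rfl⟩
    by_cases hj : j = 4
    · subst hj; exact h4
    · exact hall j hj
  obtain ⟨j, hj4, hj⟩ := hex
  obtain ⟨e0, e1, e2, e3⟩ := pderiv_f k f hf
  rcases X2Cubic4Specimen.eq_cube_index_of_ne_four j hj4 with rfl | rfl | rfl | rfl
  · refine HypersurfaceRegular.stub_hypersurfaceRegularOfPderiv k 5 f 1 P ?_
    rw [e1]; exact fun h => hj (hP'.mem_of_pow_mem 2 h)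
  · refine HypersurfaceRegular.stub_hypersurfaceRegularOfPderiv k 5 f 2 P ?_
    rw [e2]; exact fun h => hj (hP'.mem_of_pow_mem 2 h)
  · refine HypersurfaceRegular.stub_hypersurfaceRegularOfPderiv k 5 f 3 P ?_
    rw [e3]; exact fun h => hj (hP'.mem_of_pow_mem 2 h)
  · refine HypersurfaceRegular.stub_hypersurfaceRegularOfPderiv k 5 f 0 P ?_
    rw [e0]; exact fun h => hj (hP'.mem_of_pow_mem 2 h)

/-- ★ **In characteristic 2 every chart cubic is SMOOTH**: `∂w₀/∂Z₀ = 1 + 2Z₀Z₁ = 1`, `∂w₁/∂Z₁ = 1 + 2Z₁Z₂ = 1`, `∂w₂/∂Z₂ = 1 + 2Z₀Z₂ = 1` (`w₃ = w₀`) — the Jacobian certificate with a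
single cofactor (✓ `X2CubicFormSmoothCert.smooth_of_jacobian_certificate`). [elementary; cite: StacksProject, Tag 07PF] -/
theorem smooth_chartCubic [CharP k 2] (a : Fin 4) (Q : Ideal (MvPolynomial (Fin 3) k)) (hQ : Q.IsPrime)
    (hQa : MvPolynomial.aeval ((![![1, X 0, X 1, X 2], ![X 0, 1, X 1, X 2], ![X 0, X 1, 1, X 2], ![X 0, X 1, X 2, 1]] : Fin 4 → Fin 4 → MvPolynomial (Fin 3) k) a)
      (X 0 ^ 2 * X 1 + X 1 ^ 2 * X 2 + X 2 ^ 2 * X 3 + X 3 ^ 2 * X 0 : MvPolynomial (Fin 4) k) ∈ Q) :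
    ∃ D : Derivation k (MvPolynomial (Fin 3) k) (MvPolynomial (Fin 3) k),
      D (MvPolynomial.aeval ((![![1, X 0, X 1, X 2], ![X 0, 1, X 1, X 2], ![X 0, X 1, 1, X 2], ![X 0, X 1, X 2, 1]] : Fin 4 → Fin 4 → MvPolynomial (Fin 3) k) a)
        (X 0 ^ 2 * X 1 + X 1 ^ 2 * X 2 + X 2 ^ 2 * X 3 + X 3 ^ 2 * X 0 : MvPolynomial (Fin 4) k)) ∉ Q := by
  have h2 : (2 : MvPolynomial (Fin 3) k) = 0 := by
    have := CharP.cast_eq_zero (MvPolynomial (Fin 3) k) 2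
    simpa using this
  rw [dehomogenisation_cyclic] at hQa ⊢
  -- the three partial derivatives that are `1` in characteristic 2
  have d0 : pderiv 0 (X 0 + X 0 ^ 2 * X 1 + X 1 ^ 2 * X 2 + X 2 ^ 2 : MvPolynomial (Fin 3) k) = 1 := by
    simp only [map_add, Derivation.leibniz, Derivation.leibniz_pow, pderiv_X_self, smul_eq_mul, nsmul_eq_mul,
      pderiv_X_of_ne (show (1 : Fin 3) ≠ 0 by decide), pderiv_X_of_ne (show (2 : Fin 3) ≠ 0 by decide)]
    push_cast
    linear_combination (X 0 * X 1 : MvPolynomial (Fin 3) k) * h2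
  have d1 : pderiv 1 (X 0 ^ 2 + X 1 + X 1 ^ 2 * X 2 + X 0 * X 2 ^ 2 : MvPolynomial (Fin 3) k) = 1 := by
    simp only [map_add, Derivation.leibniz, Derivation.leibniz_pow, pderiv_X_self, smul_eq_mul, nsmul_eq_mul,
      pderiv_X_of_ne (show (0 : Fin 3) ≠ 1 by decide), pderiv_X_of_ne (show (2 : Fin 3) ≠ 1 by decide)]
    push_cast
    linear_combination (X 1 * X 2 : MvPolynomial (Fin 3) k) * h2
  have d2 : pderiv 2 (X 0 ^ 2 * X 1 + X 1 ^ 2 + X 2 + X 0 * X 2 ^ 2 : MvPolynomial (Fin 3) k) = 1 := by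
    simp only [map_add, Derivation.leibniz, Derivation.leibniz_pow, pderiv_X_self, smul_eq_mul, nsmul_eq_mul,
      pderiv_X_of_ne (show (0 : Fin 3) ≠ 2 by decide), pderiv_X_of_ne (show (1 : Fin 3) ≠ 2 by decide)]
    push_cast
    linear_combination (X 0 * X 2 : MvPolynomial (Fin 3) k) * h2
  obtain rfl | rfl | rfl | rfl : a = 0 ∨ a = 1 ∨ a = 2 ∨ a = 3 := by fin_cases a <;> simp
  · change (X 0 + X 0 ^ 2 * X 1 + X 1 ^ 2 * X 2 + X 2 ^ 2 : MvPolynomial (Fin 3) k) ∈ Q at hQa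
    change ∃ D : Derivation k (MvPolynomial (Fin 3) k) (MvPolynomial (Fin 3) k), D (X 0 + X 0 ^ 2 * X 1 + X 1 ^ 2 * X 2 + X 2 ^ 2 : MvPolynomial (Fin 3) k) ∉ Q
    exact X2CubicFormSmoothCert.smooth_of_jacobian_certificate k _ 0 1 0 0 (by rw [d0]; ring) Q hQ hQa
  · change (X 0 ^ 2 + X 1 + X 1 ^ 2 * X 2 + X 0 * X 2 ^ 2 : MvPolynomial (Fin 3) k) ∈ Q at hQa
    change ∃ D : Derivation k (MvPolynomial (Fin 3) k) (MvPolynomial (Fin 3) k), D (X 0 ^ 2 + X 1 + X 1 ^ 2 * X 2 + X 0 * X 2 ^ 2 : MvPolynomial (Fin 3) k) ∉ Q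
    exact X2CubicFormSmoothCert.smooth_of_jacobian_certificate k _ 0 0 1 0 (by rw [d1]; ring) Q hQ hQa
  · change (X 0 ^ 2 * X 1 + X 1 ^ 2 + X 2 + X 0 * X 2 ^ 2 : MvPolynomial (Fin 3) k) ∈ Q at hQa
    change ∃ D : Derivation k (MvPolynomial (Fin 3) k) (MvPolynomial (Fin 3) k), D (X 0 ^ 2 * X 1 + X 1 ^ 2 + X 2 + X 0 * X 2 ^ 2 : MvPolynomial (Fin 3) k) ∉ Q
    exact X2CubicFormSmoothCert.smooth_of_jacobian_certificate k _ 0 0 0 1 (by rw [d2]; ring) Q hQ hQa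
  · change (X 0 + X 0 ^ 2 * X 1 + X 1 ^ 2 * X 2 + X 2 ^ 2 : MvPolynomial (Fin 3) k) ∈ Q at hQa
    change ∃ D : Derivation k (MvPolynomial (Fin 3) k) (MvPolynomial (Fin 3) k), D (X 0 + X 0 ^ 2 * X 1 + X 1 ^ 2 * X 2 + X 2 ^ 2 : MvPolynomial (Fin 3) k) ∉ Q
    exact X2CubicFormSmoothCert.smooth_of_jacobian_certificate k _ 0 1 0 0 (by rw [d0]; ring) Q hQ hQa

/-! ## §3 ★ The rows -/

/-- ★ **THE CYCLIC-CUBIC MEMBER AT `p = 2`, F-SIDE**: for every field `k` of characteristic 2 and `f = X₄² + (Y₀²Y₁+Y₁²Y₂+Y₂²Y₃+Y₃²Y₀)(X₀..X₃)` — vertex not F-pure, scope, point floor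
LEGAL and FULL at every stalk, and the germ `FInjectivizationGermAt 2 v`. [OURS · instance of ✓ `X2CubicFormFSideChar2.fSide_classRow_smoothCubic_char2`] -/
theorem cyclic_fSide_row_char2 [CharP k 2] (f : MvPolynomial (Fin 5) k)
    (hf : f = X 4 ^ 2 + rename (Fin.castSucc : Fin 4 → Fin 5) (X 0 ^ 2 * X 1 + X 1 ^ 2 * X 2 + X 2 ^ 2 * X 3 + X 3 ^ 2 * X 0 : MvPolynomial (Fin 4) k))
    (v : Spec (.of (MvPolynomial (Fin 5) k ⧸ Ideal.span {f})))
    (hv : v.asIdeal = Ideal.span (Set.range fun j : Fin 5 => Ideal.Quotient.mk (Ideal.span {f}) (X j))) :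
    ¬ FullCl 2 ((Spec (.of (MvPolynomial (Fin 5) k ⧸ Ideal.span {f}))).presheaf.stalk v) ∧
    (IsClosed ({v} : Set (Spec (.of (MvPolynomial (Fin 5) k ⧸ Ideal.span {f})))) ∧
      v ∉ Scheme.regularLocus (Spec (.of (MvPolynomial (Fin 5) k ⧸ Ideal.span {f}))) ∧
      ringKrullDim ((Spec (.of (MvPolynomial (Fin 5) k ⧸ Ideal.span {f}))).presheaf.stalk v) = (4 : ℕ)) ∧
    (∀ (S' : Scheme.{0}) (g : S' ⟶ Spec ((Spec (.of (MvPolynomial (Fin 5) k ⧸ Ideal.span {f}))).presheaf.stalk v)),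
      IsBlowup g ((affineBlowup.idealSheaf (Ideal.span (Set.range (fun j : Fin 5 => Ideal.Quotient.mk (Ideal.span {f}) (X j))))).comap
        ((Spec (.of (MvPolynomial (Fin 5) k ⧸ Ideal.span {f}))).fromSpecStalk v)) →
      (((affineBlowup.idealSheaf (Ideal.span (Set.range (fun j : Fin 5 => Ideal.Quotient.mk (Ideal.span {f}) (X j))))).comap
          ((Spec (.of (MvPolynomial (Fin 5) k ⧸ Ideal.span {f}))).fromSpecStalk v)) ≠ ⊥ ∧
        (((((affineBlowup.idealSheaf (Ideal.span (Set.range (fun j : Fin 5 => Ideal.Quotient.mk (Ideal.span {f}) (X j))))).comap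
            ((Spec (.of (MvPolynomial (Fin 5) k ⧸ Ideal.span {f}))).fromSpecStalk v))).support :
              Set (Spec ((Spec (.of (MvPolynomial (Fin 5) k ⧸ Ideal.span {f}))).presheaf.stalk v))) ⊆
            (Scheme.regularLocus (Spec ((Spec (.of (MvPolynomial (Fin 5) k ⧸ Ideal.span {f}))).presheaf.stalk v)))ᶜ) ∧
        (∀ s : S', g.base s ≠ closedPoint ((Spec (.of (MvPolynomial (Fin 5) k ⧸ Ideal.span {f}))).presheaf.stalk v) → s ∈ Scheme.regularLocus S') ∧
        (∀ s : S', CMCl (S'.presheaf.stalk s))) ∧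
      (∀ s : S', FullCl 2 (S'.presheaf.stalk s))) ∧
    FInjectivizationGermAt 2 v := by
  obtain ⟨hnf, hscope, hrow⟩ := X2CubicFormFSideChar2.fSide_classRow_smoothCubic_char2 k _ (cyclic_isHomogeneous k) (cyclic_support_sq k) f hf (prime_f k f hf)
    (fun P _ hP => regular_off_vertex k f hf P hP) (prime_chartCubic k) (smooth_chartCubic k) v hv
  exact ⟨hnf, hscope, hrow, X2CubicFormFSideChar2.fInjectivizationGermAt_smoothCubic_char2 k _ (cyclic_isHomogeneous k) f hf (prime_f k f hf)
    (fun P _ hP => regular_off_vertex k f hf P hP) (prime_chartCubic k) (smooth_chartCubic k) v hv⟩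

/-- **The cyclic-cubic member at `p = 2`, census pair**: `¬ FullCl 2 (𝒪_{Y,v}) ∧ FInjectivizationGermAt 2 v`. [OURS · instance] -/
theorem cyclic_bad_germ_row_char2 [CharP k 2] (f : MvPolynomial (Fin 5) k)
    (hf : f = X 4 ^ 2 + rename (Fin.castSucc : Fin 4 → Fin 5) (X 0 ^ 2 * X 1 + X 1 ^ 2 * X 2 + X 2 ^ 2 * X 3 + X 3 ^ 2 * X 0 : MvPolynomial (Fin 4) k))
    (v : Spec (.of (MvPolynomial (Fin 5) k ⧸ Ideal.span {f})))
    (hv : v.asIdeal = Ideal.span (Set.range fun j : Fin 5 => Ideal.Quotient.mk (Ideal.span {f}) (X j))) :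
    ¬ FullCl 2 ((Spec (.of (MvPolynomial (Fin 5) k ⧸ Ideal.span {f}))).presheaf.stalk v) ∧ FInjectivizationGermAt 2 v :=
  ⟨(cyclic_fSide_row_char2 k f hf v hv).1, (cyclic_fSide_row_char2 k f hf v hv).2.2.2⟩

/-- **T-side by-product: lead-1's class row on the cyclic cubic at `p = 2`** — SCOPE ∧ (point floor LEGAL and FULL at every stalk) ∧ `TStepGerm.TStepInstanceAt 2 v (𝔪̃·𝒪_{Y,v})`: a
kernel T-instance outside the Fermat family (one application of ✓ `X2CubicFormTStepRow.tStep_row_of_doublePoint_cubicForm` to §1–§2). [OURS · instance of lead-1's class theorem] -/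
theorem cyclic_tStep_row_char2 [CharP k 2] (f : MvPolynomial (Fin 5) k)
    (hf : f = X 4 ^ 2 + rename (Fin.castSucc : Fin 4 → Fin 5) (X 0 ^ 2 * X 1 + X 1 ^ 2 * X 2 + X 2 ^ 2 * X 3 + X 3 ^ 2 * X 0 : MvPolynomial (Fin 4) k))
    (v : Spec (.of (MvPolynomial (Fin 5) k ⧸ Ideal.span {f})))
    (hv : v.asIdeal = Ideal.span (Set.range fun j : Fin 5 => Ideal.Quotient.mk (Ideal.span {f}) (X j))) :
    (IsClosed ({v} : Set (Spec (.of (MvPolynomial (Fin 5) k ⧸ Ideal.span {f})))) ∧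
      v ∉ Scheme.regularLocus (Spec (.of (MvPolynomial (Fin 5) k ⧸ Ideal.span {f}))) ∧
      ringKrullDim ((Spec (.of (MvPolynomial (Fin 5) k ⧸ Ideal.span {f}))).presheaf.stalk v) = (4 : ℕ)) ∧
    (∀ (S' : Scheme.{0}) (g : S' ⟶ Spec ((Spec (.of (MvPolynomial (Fin 5) k ⧸ Ideal.span {f}))).presheaf.stalk v)),
      IsBlowup g ((affineBlowup.idealSheaf (Ideal.span (Set.range (fun j : Fin 5 => Ideal.Quotient.mk (Ideal.span {f}) (X j))))).comap
        ((Spec (.of (MvPolynomial (Fin 5) k ⧸ Ideal.span {f}))).fromSpecStalk v)) →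
      ((affineBlowup.idealSheaf (Ideal.span (Set.range (fun j : Fin 5 => Ideal.Quotient.mk (Ideal.span {f}) (X j))))).comap
          ((Spec (.of (MvPolynomial (Fin 5) k ⧸ Ideal.span {f}))).fromSpecStalk v)) ≠ ⊥ ∧
      (((((affineBlowup.idealSheaf (Ideal.span (Set.range (fun j : Fin 5 => Ideal.Quotient.mk (Ideal.span {f}) (X j))))).comap
          ((Spec (.of (MvPolynomial (Fin 5) k ⧸ Ideal.span {f}))).fromSpecStalk v))).support :
            Set (Spec ((Spec (.of (MvPolynomial (Fin 5) k ⧸ Ideal.span {f}))).presheaf.stalk v))) ⊆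
          (Scheme.regularLocus (Spec ((Spec (.of (MvPolynomial (Fin 5) k ⧸ Ideal.span {f}))).presheaf.stalk v)))ᶜ) ∧
      (∀ s : S', g.base s ≠ closedPoint ((Spec (.of (MvPolynomial (Fin 5) k ⧸ Ideal.span {f}))).presheaf.stalk v) → s ∈ Scheme.regularLocus S') ∧
      (∀ s : S', FullCl 2 (S'.presheaf.stalk s))) ∧
    TStepGerm.TStepInstanceAt 2 v ((affineBlowup.idealSheaf (Ideal.span (Set.range fun j : Fin 5 => Ideal.Quotient.mk (Ideal.span {f}) (X j)))).comap
      ((Spec (.of (MvPolynomial (Fin 5) k ⧸ Ideal.span {f}))).fromSpecStalk v)) := by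
  haveI : Fact (Nat.Prime 2) := ⟨Nat.prime_two⟩
  exact X2CubicFormTStepRow.tStep_row_of_doublePoint_cubicForm k 2 _ (cyclic_isHomogeneous k) f hf (prime_f k f hf)
    (fun P _ hP => regular_off_vertex k f hf P hP) (prime_chartCubic k) (smooth_chartCubic k) v hv

end Summit.ResolutionOfSingularities.ResolutionOfSingularities.Theorems.FInjectiveMacaulayfication.X2CyclicCubicChar2

end
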